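import Summits.ValiantsHypothesis.ValiantsHypothesis.Theses.DivisionGap
import Literature.Computability.AlgebraicComplexity.RealTauConjectureDepthFour
import Literature.Computability.AlgebraicComplexity.StandardFamiliesProofs
import Literature.Computability.AlgebraicComplexity.OrbitClosure

/-!
# `DivisionGap.PerMultiplesHard` (stmt-ValiantsHypothesis-5068): the exclusion-complexity bridge —
what a refutation of the crux would cost

The crux says that every nonzero MONOTONE multiple `per_n · h` (`h ∈ ℝ≥0[x_ij]`, not charged) needs
monotone circuits of super-quasi-polynomial size; in Bürgisser's language (2004, §1.1,
`EC(g) := min {L(f) : f ≠ 0, g ∣ f}`) the monotone exclusion complexity of the permanent is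
super-quasi-polynomial.  The planner filed it with the caveat "not known to follow from `VP ≠ VNP`
(`h` may be huge)".  This file records, sorry-free, why a huge `h` buys a refuter nothing:

* `complexity_map_le` — base change along a ring homomorphism never increases the tree's
  `complexity` (map every constant; Bürgisser 2000 §4.1).
* `exists_complex_multiple_le` — **`EC_ℂ(per_n) ≤ L⁺(per_n · h)` for every `h ≠ 0`**: the
  complexification of a monotone circuit for `per_n · h` computes the nonzero complex multiple
  `per_n · h_ℂ`.
* `exclusion_quasipoly_io_of_not_perMultiplesHard` — hence `¬ PerMultiplesHard` makes the complex
  exclusion complexity of `per_n` quasi-polynomial for infinitely many `n`.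
* `borderDc_quasipoly_io_of_not_perMultiplesHard` — and therefore, GIVEN the literature bound
  "border determinantal complexity of `per_n` ≤ quasi-poly(exclusion complexity)" as an explicit
  hypothesis (Bürgisser 2004 Thm 1.3: the APPROXIMATIVE complexity of any degree-`d` polynomial is
  `≤ O(M(d)M(d⁴)·EC + d^{2γ}M(d)²)`, independent of the multiplicity — composed with depth reduction
  over `ℂ(ε)` and universality of the determinant; not yet in the tree), a refutation of the crux puts
  `\underline{dc}(per_n) ≤ 2^{(log₂ n + c)^c}` for infinitely many `n`: the quasi-polynomial
  Mulmuley–Sohoni hypothesis would fail.  Equivalently the crux follows from that hypothesis plus the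
  literature bound.  (For multiples of bounded multiplicity Kaltofen's exact-complexity theorem,
  Bürgisser 2004 Thm 1.2, gives the non-border conclusion.)

Helpers `add_le_mul_add_one`, `growth_absorb` are the elementary growth arithmetic.
-/

noncomputable section

namespace Summit.ValiantsHypothesis.Theorems.PerMultiplesHardNegative

open Literature.Computability.AlgebraicComplexity MvPolynomial
open Summit.ValiantsHypothesis.ValiantsHypothesis.Theses.DivisionGap (PerMultiplesHard)
open scoped NNReal

/-- **Base change never increases circuit complexity**: map every constant and coefficient of a
minimal circuit along `φ` (Bürgisser 2000 §4.1). [cite: Burgisser2000, §4.1] -/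
theorem complexity_map_le {k k' : Type*} [CommSemiring k] [CommSemiring k'] {σ : Type*}
    (φ : k →+* k') (f : MvPolynomial σ k) :
    complexity (MvPolynomial.map φ f) ≤ complexity f := by
  obtain ⟨P, h2, hf, hs⟩ := ArithCircuit.exists_computes_size_eq_complexity f
  rw [← hs, ← ArithCircuit.size_map φ P]
  exact ArithCircuit.complexity_le_size (h2.map φ) (hf.map φ)

/-- The complexification `ℝ≥0 → ℝ → ℂ` is injective. [folklore] -/
theorem toC_injective : Function.Injective (Complex.ofRealHom.comp NNReal.toRealHom) := by
  intro a b h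
  have h' : ((a : ℝ) : ℂ) = ((b : ℝ) : ℂ) := h
  exact_mod_cast h'

/-- **`EC_ℂ(per_n) ≤ L⁺(per_n · h)`**: every nonzero monotone multiple of the permanent becomes, after
complexification, a nonzero complex multiple of `per_n` of no larger circuit complexity.
[cite: Burgisser2004Factors, §1.1] -/
theorem exists_complex_multiple_le {n : ℕ} {h : MvPolynomial (Fin n × Fin n) ℝ≥0} (hh : h ≠ 0) :
    ∃ f : MvPolynomial (Fin n × Fin n) ℂ, f ≠ 0 ∧ perPoly (Fin n) ℂ ∣ f ∧
      complexity f ≤ complexity (perPoly (Fin n) ℝ≥0 * h) := by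
  classical
  refine ⟨MvPolynomial.map (Complex.ofRealHom.comp NNReal.toRealHom) (perPoly (Fin n) ℝ≥0 * h),
    ?_, ?_, complexity_map_le _ _⟩
  · intro h0
    apply mul_ne_zero (perPoly_ne_zero (Fin n) ℝ≥0) hh
    apply MvPolynomial.map_injective _ toC_injective
    rw [h0, map_zero]
  · exact ⟨MvPolynomial.map _ h, by rw [map_mul, map_perPoly]⟩

/-- **A refutation makes the complex exclusion complexity of the permanent quasi-polynomial
infinitely often.** [cite: Burgisser2004Factors, §1.1] -/
theorem exclusion_quasipoly_io_of_not_perMultiplesHard (hneg : ¬ PerMultiplesHard) :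
    ∃ c : ℕ, ∀ n₀ : ℕ, ∃ n ≥ n₀, ∃ f : MvPolynomial (Fin n × Fin n) ℂ, f ≠ 0 ∧ perPoly (Fin n) ℂ ∣ f ∧
      complexity f ≤ 2 ^ ((Nat.log 2 n + c) ^ c) := by
  unfold PerMultiplesHard at hneg
  push Not at hneg
  obtain ⟨c, hc⟩ := hneg
  refine ⟨c, fun n₀ => ?_⟩
  obtain ⟨n, hn, h, hh, hle⟩ := hc n₀
  obtain ⟨f, hf0, hdvd, hfc⟩ := exists_complex_multiple_le hh
  exact ⟨n, hn, f, hf0, hdvd, hfc.trans hle⟩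

/-- Arithmetic: `T + P ≤ T·P + 1` for `T, P ≥ 1`. [folklore] -/
theorem add_le_mul_add_one {T P : ℕ} (hT : 1 ≤ T) (hP : 1 ≤ P) : T + P ≤ T * P + 1 := by
  obtain ⟨t, rfl⟩ : ∃ t, T = t + 1 := ⟨T - 1, by omega⟩
  obtain ⟨p, rfl⟩ : ∃ p, P = p + 1 := ⟨P - 1, by omega⟩
  nlinarith [Nat.zero_le (t * p)]

/-- Arithmetic: one quasi-polynomial exponent absorbs the composition of two. [folklore] -/
theorem growth_absorb (L c a : ℕ) :
    ((L + c) ^ c + (L + 1) + a) ^ a ≤ (L + (c + a + 2) * (a + 1)) ^ ((c + a + 2) * (a + 1)) := by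
  have h1 : 1 ≤ (L + c) ^ c := by
    cases c with
    | zero => simp
    | succ k => exact Nat.one_le_pow _ _ (by omega)
  have hA : (L + c) ^ c + (L + 1) + a ≤ (L + c + a + 2) ^ (c + 1) := by
    have hmono : (L + c) ^ c ≤ (L + c + a + 2) ^ c := Nat.pow_le_pow_left (by omega) c
    have e1 := Nat.mul_le_mul_right (L + c + a + 2) hmono
    have e2 := Nat.mul_le_mul_right (L + c + a + 1) h1
    rw [pow_succ]
    nlinarith [e1, e2]
  calc ((L + c) ^ c + (L + 1) + a) ^ a
      ≤ ((L + c + a + 2) ^ (c + 1)) ^ a := Nat.pow_le_pow_left hA a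
    _ = (L + c + a + 2) ^ ((c + 1) * a) := by rw [← pow_mul]
    _ ≤ (L + (c + a + 2) * (a + 1)) ^ ((c + 1) * a) := Nat.pow_le_pow_left (by nlinarith) _
    _ ≤ (L + (c + a + 2) * (a + 1)) ^ ((c + a + 2) * (a + 1)) :=
        Nat.pow_le_pow_right (by nlinarith) (by nlinarith)

/-- **The cost of a refutation.** GIVEN the literature bound `H` ("the border determinantal
complexity of `per_n` is quasi-polynomial in the complexity of any nonzero complex multiple":
Bürgisser 2004 Thm 1.3 — approximative complexity of a degree-`d` factor `≤ poly(d) · EC`,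
multiplicity-free — composed with depth reduction over `ℂ(ε)` and universality of the determinant,
Bürgisser 2004 §5 / Bürgisser–Landsberg–Manivel–Weyman 2011 §9), a refutation of `PerMultiplesHard`
yields `\underline{dc}(per_n) ≤ 2^{(log₂ n + c)^c}` for infinitely many `n` — the failure of the
quasi-polynomial Mulmuley–Sohoni hypothesis `per ∉ \overline{VQP}` (a.e. form).
[cite: Burgisser2004Factors, Thm 1.3] -/
theorem borderDc_quasipoly_io_of_not_perMultiplesHard
    (H : ∃ a : ℕ, ∀ n : ℕ, ∀ f : MvPolynomial (Fin n × Fin n) ℂ, f ≠ 0 → perPoly (Fin n) ℂ ∣ f →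
      borderDetComplexityPer ℂ n ≤ 2 ^ ((Nat.log 2 (complexity f + n) + a) ^ a))
    (hneg : ¬ PerMultiplesHard) :
    ∃ c : ℕ, ∀ n₀ : ℕ, ∃ n ≥ n₀, borderDetComplexityPer ℂ n ≤ 2 ^ ((Nat.log 2 n + c) ^ c) := by
  obtain ⟨a, ha⟩ := H
  obtain ⟨c, hc⟩ := exclusion_quasipoly_io_of_not_perMultiplesHard hneg
  refine ⟨(c + a + 2) * (a + 1), fun n₀ => ?_⟩
  obtain ⟨n, hn, f, hf0, hdvd, hfc⟩ := hc n₀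
  refine ⟨n, hn, ?_⟩
  have hle := ha n f hf0 hdvd
  have hT : 1 ≤ 2 ^ ((Nat.log 2 n + c) ^ c) := Nat.one_le_two_pow
  have hP : 1 ≤ 2 ^ (Nat.log 2 n + 1) := Nat.one_le_two_pow
  have hnlt : n < 2 ^ (Nat.log 2 n + 1) := Nat.lt_pow_succ_log_self (by norm_num) n
  have hkey := add_le_mul_add_one hT hP
  have hsum : complexity f + n ≤ 2 ^ ((Nat.log 2 n + c) ^ c + (Nat.log 2 n + 1)) := by
    rw [pow_add]
    omega
  have hlog : Nat.log 2 (complexity f + n) ≤ (Nat.log 2 n + c) ^ c + (Nat.log 2 n + 1) := by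
    have := Nat.log_mono_right (b := 2) hsum
    rwa [Nat.log_pow (by norm_num)] at this
  have hexp : (Nat.log 2 (complexity f + n) + a) ^ a ≤
      (Nat.log 2 n + (c + a + 2) * (a + 1)) ^ ((c + a + 2) * (a + 1)) :=
    (Nat.pow_le_pow_left (Nat.add_le_add_right hlog a) a).trans (growth_absorb (Nat.log 2 n) c a)
  exact hle.trans (Nat.pow_le_pow_right (by norm_num) hexp)

end Summit.ValiantsHypothesis.Theorems.PerMultiplesHardNegative

end
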